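import Mathlib
import Summits.Ventures.PercRepro2.K5HyperK3

/-!
# THE CRUX KERNEL `K₃` STAR COMPARISONS `M-TRI` AND `TvT-TRI` ON `K₅`: THE KRONECKER NUMBERS
(blind cell PercRepro2, typer-1 g10; mine-1 §23.12 — `M-TRI ≥ 0` on all `30` `(T, e)`, `TvT-TRI ≥ 0` on the
`7` non-root-pair triangles, census-true exhaustively)

With `posOn3` / `negOn3` (`K5HyperK3.lean`) and the placement sums of `K5HyperI.lean`, the (TRI) count
being `pos − neg`: `M-TRI ≥ 0 ⟺ posT1e1 + negT1 ≥ negT1e1 + posT1` and `TvT-TRI ≥ 0 ⟺ posE3 + negT1 ≥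
negE3 + posT1` digitwise.  These certificates are the largest of the cell (`240` / `600` products of three
Kronecker numbers); they need `maxHeartbeats 0` (the kernel's deterministic timeout, not memory, is the
wall — `K5HyperCertK3M*.lean` / `K5HyperCertK3TvT*.lean`).
-/

namespace Summit.Ventures.PercRepro2

namespace K5

/-- **`M-TRI ≥ 0` as Kronecker numbers**: `kPosM3 = N(H+T(1)+e(1))⁺ + N(H+T(1))⁻`. -/
def kPosM3 (D P : Fin 10 → Bool) : ℕ := sumT1e1 posOn3 D P + sumT1 negOn3 D

/-- The other side of `M-TRI`. -/
def kNegM3 (D P : Fin 10 → Bool) : ℕ := sumT1e1 negOn3 D P + sumT1 posOn3 D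

/-- **`TvT-TRI ≥ 0` as Kronecker numbers**: `kPosTvT3 = N(H+△(1,1,1))⁺ + N(H+T(1))⁻`. -/
def kPosTvT3 (a b c : ℕ) : ℕ :=
  sumE3 posOn3 (pairMask a b) (pairMask a c) (pairMask b c) + sumT1 negOn3 (triMask a b c)

/-- The other side of `TvT-TRI`. -/
def kNegTvT3 (a b c : ℕ) : ℕ :=
  sumE3 negOn3 (pairMask a b) (pairMask a c) (pairMask b c) + sumT1 posOn3 (triMask a b c)

end K5

end Summit.Ventures.PercRepro2
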